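import Summits.ValiantsHypothesis.ValiantsHypothesis.Theorems.GrenetZeonDualUnipotentThreeHalvesLongMassResolventFlag

/-!
# RESOLVENT FLAGS for crux 24318 (c) — the EXACT dictionary `[s^d](A+sB)^b = [u^{b−d}](T^d·R_A)` and `Ledger ⟺ ONE CONGRUENCE` (row r8, part 2/2; val-idea-30 g7 rev 3 §Q, ported by name)

§Q: `pow_lineSubst_apply_eq_sum`, `coeff_pow_lineSubst_apply` (the identity for ALL `b, d`, no hypothesis on the twist), ★★ `ledger_top_iff_twist_pow_congr :
Ledger n m N (fun _ => True) K k ↔ ∀ x v, v ∈ K → ∀ i j, ∀ e, e + k + 2 ≤ n → coeff (((twist N x v) ^ (k + 1)) i j) e = 0` (the instrument is EXACT: a whole-pencil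
ledger is ONE matrix congruence of degree `k+1` in `v` per point `x`), `relCert_of_twist_pow_congr` (congruence certificate, price `n·k + codim K`).

Port (val-lit-p3 g18, desk #399) of val-idea-30 g7's `Cruxes/DualUnipotentThreeHalves/ResolventFlag.lean` REV 3 (tree sha16 c47d387411ee7036, 472 l.,
farm rc 0/0/0/0, axioms std; critic of record val-idea-crit-7 g3 V36/V44: «the exact dictionary is CORRECT») — decl bodies VERBATIM by name, namespace
`…Cruxes.DualUnipotentThreeHalves.ResolventFlag` → `…Theorems.GrenetZeon.ResolventFlag`, split in two at the §P/§Q seam for the 400-line convention (the §P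
helpers that §Q uses lose `private`, visibility only).  ROW r8 of crit-7's (c) class table: an INSTRUMENT / support row — every resolvent-flag / resolvent-index
computation of the (c)-programme is a kernel `SlowCore.Ledger`; never an `IrreducibleInv` constituent; NOT progress on (c) `LongMassSlowLawInv` (RESEARCH — OPEN);
24318 / S3 / R2ᵖ OPEN; VP ≠ VNP is NOT proved.  Helper (`--supports stmt-ValiantsHypothesis-24318 --as helper`).  Credit: mathematics and kernel proofs
val-idea-30 g6/g7; vocabulary val-idea-26 g5 / val-port-2 g3 (✓ `…SlowCoreLedger`).  No instances, no notation, no named facts.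
-/

set_option linter.dupNamespace false

namespace Summit.ValiantsHypothesis.ValiantsHypothesis.Theorems.GrenetZeon.ResolventFlag

open MvPolynomial Matrix
open scoped BigOperators Polynomial
open Summit.ValiantsHypothesis.ValiantsHypothesis.Cruxes.TwoDimCoefficients.DimTwoCases (AffMat IsAffine)
open Summit.ValiantsHypothesis.ValiantsHypothesis.Theorems.GrenetZeon.SlowCore (linEntry Ledger RelCert)

/-! ## §Q (val-idea-30 g7, rev 3) The EXACT dictionary in kernel: `[s^d](A+sB)^b = [u^{b−d}](T^d·R_A)` for ALL `b, d`, and `Ledger ⟺ ONE CONGRUENCE` (memo (D2); crit-7 V36 (D))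

No hypothesis on the twist is needed for the identity: with `G_b := Σ_{d ≤ b} (σu·T)^d` one has `(1 − σuT)·G_b = 1 − E`,
`E := (σu·T)^{b+1}`, so `(1 − uM)(G_b R_A) = 1 − E'` with `E' := (1 − uA)·E·R_A`, and
`Σ_{a ≤ b}(uM)^a = G_b R_A − (uM)^{b+1} G_b R_A + (Σ_{a≤b}(uM)^a)·E'`; both error terms are multiples of `u^{b+1}`, whence
`(M^b)_{ij} = Σ_{d ≤ b} s^d · [u^{b−d}](T^d R_A)_{ij}` EXACTLY (`pow_lineSubst_apply_eq_sum`, `coeff_pow_lineSubst_apply`).  Consequence: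
  `Ledger n m N ⊤ K k  ⟺  ∀ x, ∀ v ∈ K: (R_{N(x)}(u)·lin v)^{k+1} ≡ 0 mod u^{n−1−k}`
(`ledger_top_iff_twist_pow_congr`; coefficientwise: `coeff_e ((twist N x v)^(k+1))_{ij} = 0` whenever `e + k + 2 ≤ n`), and the sharper
certificate form `relCert_of_twist_pow_congr` (a congruence instead of exact vanishing; strictly more certificates once `(k+1)(m−1) > n−2−k`).
So the instrument is EXACT: a whole-pencil ledger `(K, k)` is ONE matrix congruence of degree `k+1` in `v` per point `x`, nothing more, nothing less.
-/

section Proof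

open Polynomial (coeff)
open Summit.ValiantsHypothesis.ValiantsHypothesis.Theorems.GrenetZeon.RadicalSplit (lineSubst)
open Summit.ValiantsHypothesis.ValiantsHypothesis.Theorems.GrenetZeon.SlowCore (lineSubst_apply_of_le_one)

variable {n m : ℕ}

/-- `R_A·(1 − u·A) = 1` over `ℂ[u]` (right-inverse form of `one_sub_smul_mul_resolvent`). -/
private theorem resolvent_mul_one_sub_smul (N : AffMat n m) (hnil : N ^ m = 0) (x : Fin n × Fin n → ℂ) :
    resolvent N x * (1 - (Polynomial.X : ℂ[X]) • (pointMat N x).map Polynomial.C) = 1 := by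
  rw [resolvent_eq_geom_sum, geom_sum_mul_neg, smul_pow,
    ← Matrix.map_pow (pointMat N x) (Polynomial.C : ℂ →+* ℂ[X]) m]
  change 1 - (Polynomial.X : ℂ[X]) ^ m • ((pointMat N x) ^ m).map Polynomial.C = 1
  rw [pointMat_pow_eq_zero N hnil x]
  ext i j
  simp

/-- **EXACT DICTIONARY (universal identity; no hypothesis on the twist).**  For EVERY exponent `b` and entry `(i,j)`:
`(N(x+sv)^b)_{ij} = Σ_{d ≤ b} s^d · C([u^{b−d}] (T^d · R_A)_{ij})` with `T = twist N x v = R_{N(x)}(u)·lin v`, `R_A = resolvent N x` —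
i.e. `[s^d](A+sB)^b = [u^{b−d}](T^d R_A)` (memo (D1), Kato's second Neumann series read coefficientwise, here as a finite identity). -/
theorem pow_lineSubst_apply_eq_sum (N : AffMat n m) (hN : IsAffine N) (hnil : N ^ m = 0)
    (x v : Fin n × Fin n → ℂ) (b : ℕ) (i j : Fin m) :
    ((N.map (lineSubst x v)) ^ b) i j =
      ∑ d ∈ Finset.range (b + 1), (MvPolynomial.X 0 : MvPolynomial (Fin 1) ℂ) ^ d *
        MvPolynomial.C (coeff (((twist N x v) ^ d * resolvent N x) i j) (b - d)) := by
  classical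
  set M : Matrix (Fin m) (Fin m) SRing := N.map (lineSubst x v) with hM
  set Mu : Matrix (Fin m) (Fin m) (Polynomial SRing) := M.map Polynomial.C with hMu
  set Au : Matrix (Fin m) (Fin m) (Polynomial SRing) := cst (pointMat N x) with hAu
  set Bu : Matrix (Fin m) (Fin m) (Polynomial SRing) := cst (linMat N v) with hBu
  set RA : Matrix (Fin m) (Fin m) (Polynomial SRing) := transport m (resolvent N x) with hRA
  set T : Matrix (Fin m) (Fin m) (Polynomial SRing) := transport m (twist N x v) with hTdef
  set u : Polynomial SRing := Polynomial.X with hu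
  set σ : Polynomial SRing := Polynomial.C (MvPolynomial.X 0 : SRing) with hσ
  -- (1) `(1 − uA) R_A = 1`
  have h1 : (1 - u • Au) * RA = 1 := by
    have h0 := congrArg (transport m) (one_sub_smul_mul_resolvent N hnil x)
    rw [map_mul, map_one, map_sub, map_one, transport_X_smul, transport_map_C, ← hu, ← hAu, ← hRA] at h0
    exact h0
  -- (2) `T = R_A · B`
  have hT' : T = RA * Bu := by
    rw [hTdef, twist, map_mul, transport_map_C, ← hRA, ← hBu]
  -- (3') truncated geometric sum `(1 − σu·T) G = 1 − E`
  set G : Matrix (Fin m) (Fin m) (Polynomial SRing) := ∑ d ∈ Finset.range (b + 1), ((σ * u) • T) ^ d with hG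
  set E : Matrix (Fin m) (Fin m) (Polynomial SRing) := ((σ * u) • T) ^ (b + 1) with hE
  have h3 : (1 - (σ * u) • T) * G = 1 - E := by
    rw [hG, hE, mul_neg_geom_sum]
  -- (4') `M = A + σ B`, `1 − uM = (1 − uA)(1 − σu T)`, `(1 − uM)(G R_A) = 1 − E'`
  have hMu' : Mu = Au + σ • Bu := by
    rw [hMu, hM, hAu, hBu, hσ]
    exact map_lineSubst_map_C N hN x v
  have h4 : 1 - u • Mu = (1 - u • Au) * (1 - (σ * u) • T) := by
    rw [mul_sub, mul_one, Matrix.mul_smul, hT', ← Matrix.mul_assoc, h1, Matrix.one_mul, hMu', smul_add,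
      ← mul_smul, mul_comm u σ]
    abel
  set E' : Matrix (Fin m) (Fin m) (Polynomial SRing) := (1 - u • Au) * (E * RA) with hE'
  have h5 : (1 - u • Mu) * (G * RA) = 1 - E' := by
    have h35 : (1 - (σ * u) • T) * (G * RA) = RA - E * RA := by
      rw [← Matrix.mul_assoc, h3, sub_mul 1 E RA, Matrix.one_mul]
    rw [h4, Matrix.mul_assoc, h35, mul_sub (1 - u • Au) RA (E * RA), h1]
  -- (5') geometric sum for `uM`, with the error term `S·E'`
  set S : Matrix (Fin m) (Fin m) (Polynomial SRing) := ∑ a ∈ Finset.range (b + 1), (u • Mu) ^ a with hS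
  have hgs : S * (1 - u • Mu) = 1 - (u • Mu) ^ (b + 1) := by
    rw [hS]
    exact geom_sum_mul_neg _ _
  have h6 : S = G * RA - (u • Mu) ^ (b + 1) * (G * RA) + S * E' := by
    calc S = S * ((1 - u • Mu) * (G * RA) + E') := by rw [h5, sub_add_cancel, Matrix.mul_one]
      _ = S * (1 - u • Mu) * (G * RA) + S * E' := by rw [Matrix.mul_add, Matrix.mul_assoc]
      _ = (1 - (u • Mu) ^ (b + 1)) * (G * RA) + S * E' := by rw [hgs]
      _ = G * RA - (u • Mu) ^ (b + 1) * (G * RA) + S * E' := by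
          rw [sub_mul 1 ((u • Mu) ^ (b + 1)) (G * RA), Matrix.one_mul]
  -- (6') compare the `u^b` coefficients of the `(i,j)` entries
  have hcoef : coeff (S i j) b = coeff ((G * RA - (u • Mu) ^ (b + 1) * (G * RA) + S * E') i j) b :=
    congrArg (fun Z : Matrix (Fin m) (Fin m) (Polynomial SRing) => coeff (Z i j) b) h6
  have hterm : ∀ a : ℕ, coeff (((u • Mu) ^ a) i j) b = if b = a then (M ^ a) i j else 0 := by
    intro a
    rw [smul_pow, Matrix.smul_apply, smul_eq_mul, hMu, ← Matrix.map_pow M (Polynomial.C : SRing →+* _) a]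
    change coeff (u ^ a * Polynomial.C ((M ^ a) i j)) b = _
    rw [mul_comm, hu, Polynomial.coeff_C_mul_X_pow]
  have hL : coeff (S i j) b = (M ^ b) i j := by
    rw [hS, Matrix.sum_apply, Polynomial.finsetSum_coeff,
      Finset.sum_eq_single_of_mem b (Finset.mem_range.2 (Nat.lt_succ_self b))
        (fun a _ hab => by rw [hterm a, if_neg (Ne.symm hab)]),
      hterm b, if_pos rfl]
  have hR2 : coeff (((u • Mu) ^ (b + 1) * (G * RA)) i j) b = 0 := by
    rw [smul_pow, Matrix.smul_mul, Matrix.smul_apply, smul_eq_mul, hu, Polynomial.coeff_X_pow_mul',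
      if_neg (by omega)]
  -- the new error term is a multiple of `u^{b+1}` as well
  have hR3 : coeff ((S * E') i j) b = 0 := by
    rw [hE', hE, smul_pow, mul_pow, mul_comm (σ ^ (b + 1)) (u ^ (b + 1)), mul_smul, Matrix.smul_mul,
      Matrix.mul_smul, Matrix.mul_smul, Matrix.smul_apply, smul_eq_mul, hu, Polynomial.coeff_X_pow_mul',
      if_neg (by omega)]
  have hR1 : coeff ((G * RA) i j) b = ∑ d ∈ Finset.range (b + 1),
      (if d ≤ b then (MvPolynomial.X 0 : SRing) ^ d *
        MvPolynomial.C (coeff (((twist N x v) ^ d * resolvent N x) i j) (b - d)) else 0) := by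
    rw [hG, Finset.sum_mul, Matrix.sum_apply, Polynomial.finsetSum_coeff]
    refine Finset.sum_congr rfl fun d _ => ?_
    rw [smul_pow, Matrix.smul_mul, Matrix.smul_apply, smul_eq_mul, hTdef, hRA, ← map_pow, ← map_mul,
      transport_apply, mul_pow, hσ, ← Polynomial.C_pow, mul_assoc, Polynomial.coeff_C_mul, hu,
      Polynomial.coeff_X_pow_mul']
    by_cases hdb : d ≤ b
    · rw [if_pos hdb, if_pos hdb, Polynomial.coeff_map]
    · rw [if_neg hdb, if_neg hdb, mul_zero]
  rw [hL, Matrix.add_apply, Matrix.sub_apply, Polynomial.coeff_add, Polynomial.coeff_sub, hR2, hR3,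
    sub_zero, add_zero, hR1] at hcoef
  rw [hcoef]
  exact Finset.sum_congr rfl fun d hd => if_pos (Nat.lt_succ_iff.1 (Finset.mem_range.1 hd))

/-- Monomials of the one-variable `s`-ring. -/
private theorem X_pow_mul_C_eq_monomial (d : ℕ) (c : ℂ) :
    (MvPolynomial.X 0 : SRing) ^ d * MvPolynomial.C c = MvPolynomial.monomial (Finsupp.single 0 d) c := by
  rw [MvPolynomial.X_pow_eq_monomial, MvPolynomial.C_apply, MvPolynomial.monomial_mul, add_zero, one_mul]

/-- **`s^d`-COEFFICIENT FORMULA** (exact dictionary, entrywise): `[s^d] (N(x+sv)^b)_{ij} = [u^{b−d}] (T^d · R_A)_{ij}` for `d ≤ b`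
(and `0` for `d > b`). -/
theorem coeff_pow_lineSubst_apply (N : AffMat n m) (hN : IsAffine N) (hnil : N ^ m = 0)
    (x v : Fin n × Fin n → ℂ) (b d : ℕ) (i j : Fin m) :
    MvPolynomial.coeff (Finsupp.single 0 d) (((N.map (lineSubst x v)) ^ b) i j) =
      if d ≤ b then coeff (((twist N x v) ^ d * resolvent N x) i j) (b - d) else 0 := by
  classical
  rw [pow_lineSubst_apply_eq_sum N hN hnil x v b i j, MvPolynomial.coeff_sum]
  simp_rw [X_pow_mul_C_eq_monomial, MvPolynomial.coeff_monomial, (Finsupp.single_injective (0 : Fin 1)).eq_iff]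
  simp only [Finset.sum_ite_eq', Finset.mem_range, Nat.lt_succ_iff]

/-- **LEDGER ⟺ ONE CONGRUENCE (the exact dictionary (D2) in kernel).**  `(K, k)` is a whole-pencil ledger of `N` iff at every
point `x`, for every `v ∈ K`, `(R_{N(x)}(u)·lin v)^{k+1} ≡ 0 mod u^{n−1−k}` — all `u`-coefficients of index `e ≤ n−2−k` of the
`(k+1)`-st power of the twist vanish.  (`⇐` is the certificate direction; `⇒` says the resolvent instrument loses nothing.) -/
theorem ledger_top_iff_twist_pow_congr (N : AffMat n m) (hN : IsAffine N) (hnil : N ^ m = 0)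
    (K : Submodule ℂ (Fin n × Fin n → ℂ)) (k : ℕ) :
    Ledger n m N (fun _ => True) K k ↔
      ∀ x v : Fin n × Fin n → ℂ, v ∈ K → ∀ i j : Fin m, ∀ e : ℕ, e + k + 2 ≤ n →
        coeff (((twist N x v) ^ (k + 1)) i j) e = 0 := by
  classical
  constructor
  · intro hL x v hv i j e he
    -- Step A: `T^{k+1}·R_A ≡ 0 mod u^{n−1−k}` from the `s^{k+1}`-coefficients of the powers `b = e' + k + 1 ≤ n − 1`
    have hA : ∀ (i' j' : Fin m) (e' : ℕ), e' + k + 2 ≤ n →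
        coeff (((twist N x v) ^ (k + 1) * resolvent N x) i' j') e' = 0 := by
      intro i' j' e' he'
      have hdeg := hL x v hv (e' + k + 1) (by omega) i' j' trivial trivial
      have hz : MvPolynomial.coeff (Finsupp.single 0 (k + 1)) (((N.map (lineSubst x v)) ^ (e' + k + 1)) i' j') = 0 :=
        MvPolynomial.coeff_eq_zero_of_totalDegree_lt (by
          rw [Finsupp.support_single _ (Nat.succ_ne_zero k), Finset.sum_singleton, Finsupp.single_eq_same]
          omega)
      rw [coeff_pow_lineSubst_apply N hN hnil x v (e' + k + 1) (k + 1) i' j', if_pos (by omega),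
        show e' + k + 1 - (k + 1) = e' by omega] at hz
      exact hz
    -- Step B: `T^{k+1} = (T^{k+1} R_A)(1 − uA)`
    have hTk : (twist N x v) ^ (k + 1) = ((twist N x v) ^ (k + 1) * resolvent N x) *
        (1 - (Polynomial.X : ℂ[X]) • (pointMat N x).map Polynomial.C) := by
      rw [Matrix.mul_assoc, resolvent_mul_one_sub_smul N hnil x, Matrix.mul_one]
    rw [hTk, Matrix.mul_sub, Matrix.mul_one, Matrix.mul_smul, Matrix.sub_apply, Matrix.smul_apply, smul_eq_mul,
      Polynomial.coeff_sub, hA i j e he, zero_sub, neg_eq_zero, ← pow_one (Polynomial.X : ℂ[X]),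
      Polynomial.coeff_X_pow_mul']
    by_cases he1 : 1 ≤ e
    · rw [if_pos he1, Matrix.mul_apply, Polynomial.finsetSum_coeff]
      refine Finset.sum_eq_zero fun l _ => ?_
      rw [Matrix.map_apply, Polynomial.coeff_mul_C, hA i l (e - 1) (by omega), zero_mul]
    · rw [if_neg he1]
  · intro hC x v hv b hb i j _ _
    rw [pow_lineSubst_apply_eq_sum N hN hnil x v b i j]
    refine (MvPolynomial.totalDegree_finsetSum _ _).trans (Finset.sup_le fun d hd => ?_)
    have hdb : d ≤ b := Nat.lt_succ_iff.1 (Finset.mem_range.1 hd)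
    by_cases hdk : d ≤ k
    · refine (MvPolynomial.totalDegree_mul _ _).trans ?_
      rw [MvPolynomial.totalDegree_C, add_zero]
      exact (MvPolynomial.totalDegree_X_pow (R := ℂ) (0 : Fin 1) d).le.trans hdk
    · -- `d ≥ k+1`: the coefficient `[u^{b−d}](T^d R_A)_{ij}` vanishes by the congruence
      have hz : coeff (((twist N x v) ^ d * resolvent N x) i j) (b - d) = 0 := by
        obtain ⟨d', rfl⟩ : ∃ d', d = (k + 1) + d' := ⟨d - (k + 1), by omega⟩
        rw [pow_add, Matrix.mul_assoc, Matrix.mul_apply, Polynomial.finsetSum_coeff]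
        refine Finset.sum_eq_zero fun l _ => ?_
        rw [Polynomial.coeff_mul]
        refine Finset.sum_eq_zero fun p hp => ?_
        have hp' := Finset.HasAntidiagonal.mem_antidiagonal.1 hp
        rw [hC x v hv i l p.1 (by omega), zero_mul]
      rw [hz, MvPolynomial.C_0, mul_zero, MvPolynomial.totalDegree_zero]
      exact Nat.zero_le _

/-- ✓ **Sharper pluggable form for (c)** (a CONGRUENCE certificate): if for all `x` and `v ∈ K` the `u`-coefficients of index
`≤ n−2−k` of `(R_{N(x)}(u)·lin v)^{k+1}` vanish, then `(K, k)` is a whole-pencil `RelCert` of price `n·k + codim K`. -/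
theorem relCert_of_twist_pow_congr (N : AffMat n m) (hN : IsAffine N) (hnil : N ^ m = 0)
    (K : Submodule ℂ (Fin n × Fin n → ℂ)) (k : ℕ)
    (hK : ∀ x v : Fin n × Fin n → ℂ, v ∈ K → ∀ i j : Fin m, ∀ e : ℕ, e + k + 2 ≤ n →
      coeff (((twist N x v) ^ (k + 1)) i j) e = 0) :
    RelCert n m N (n * k + (n * n - Module.finrank ℂ K)) :=
  ⟨K, k, (ledger_top_iff_twist_pow_congr N hN hnil K k).2 hK, le_rfl⟩

end Proof

end Summit.ValiantsHypothesis.ValiantsHypothesis.Theorems.GrenetZeon.ResolventFlag
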